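import Summits.QuantumFields.YangMills.Theorems.MirrorModularBoostsCurvatureBoostCovarianceDominatedTieLimitRiemannSum
import Summits.QuantumFields.YangMills.Theorems.MirrorModularBoostsCurvatureBoostCovarianceDominatedTieLimit
import Summits.QuantumFields.YangMills.Theorems.CurvatureBoostCovariance.Negative.Unbundled
import Summits.QuantumFields.YangMills.Theorems.NPointIsotropy.Negative.TieLoadBearing
import HarnessLib

/-!
# Step 0, continuum ⇒ lattice: tempered lattice approximants from a tempered-continuous density — stub `stub_latticeApproximants_of_continuousRegular`

Line `complex-rotation-bandlimit` of crux `PencilRigidity.NPointIsotropy` (stmt-QuantumFields-11686),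
Stub 1d of generation 10 of the registered skeleton `Cruxes/NPointIsotropy/Lines/complex_rotation_bandlimit.lean`
(registered side stub; the CONVERSE of the reshape-8 decomposition of Step 0 on the sibling crux
stmt-QuantumFields-9663, whose two analysis halves `stub_dominatedTieLimit`, `stub_regular_of_dominated` are landed).

Statement (`stub_latticeApproximants_of_continuousRegular`, registered signature verbatim).  Let the
one-species family `S₁` be TIED to `(r, sch)` (`Tie`: on off-diagonal real product tensors of positive
degree, `S₁ n F` is the limit of the real lattice `n`-point numbers of the curvature string), let `n ≥ 1`,
and suppose `𝔖ₙ|⁰𝒮` is integration against a function `W : (ℝ⁴)ⁿ → ℂ`, continuous off the coincidence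
locus `A = {∃ i ≠ j, yᵢ = yⱼ}` and tempered there,
`‖W y‖ ≤ C (1 + ‖y‖)^N (1 + Σ_i Σ_{j ≠ i} ‖yᵢ - yⱼ‖⁻¹)^N`, with `W · F ∈ L¹` and `S₁ n F = ∫ W · F` for
every `F ∈ ⁰𝒮`.  Then there are lattice densities `D_k : (ℤ⁴)ⁿ → ℝ`, constants `C > 0`, `N`, `k₀` with
`|D_k x| ≤ C (1 + ‖a_k x‖)^N (1 + Σ_i Σ_{j ≠ i} ‖a_k xᵢ - a_k xⱼ‖⁻¹)^N` at injective multi-sites of the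
box for `k ≥ k₀`, whose Riemann sums `(a_k⁴)ⁿ Σ_{x ∈ (box 4 L_k)ⁿ} (∏ᵢ fᵢ(a_k xᵢ)) D_k x` converge to
`S₁ n F` on every off-diagonal real product tensor `F = ⊗ᵢ fᵢ`.

Proof.  Witness `D_k x := Re W(a_k x)`, the same `C`, `N`, and `k₀ := 0`.
* Bound: `siteToE : ℤ⁴ → ℝ⁴` is injective and `a_k > 0`, so an injective multi-site scaled by `a_k` is
  off the locus, where `|Re W| ≤ ‖W‖` is bounded by hypothesis.
* Convergence: on a real tensor, `F(a_k x) = ∏ᵢ fᵢ(a_k xᵢ) ∈ ℝ`, so the lattice sum is the Riemann sum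
  `(a_k⁴)ⁿ Σ_x g(a_k x)` of the REAL function `g = Re (W · F)`.  By the flat decay of `⁰𝒮` functions
  against the pair weight (`DominatedTieLimit.norm_mul_weight_le`, exponent `M = 8n`),
  `‖g y‖ ≤ ‖F y‖ ‖W y‖ ≤ K (1 + ‖y‖)^{-8n}` with `8n > 4n = dim`; `g` is continuous off the Lebesgue-null
  closed locus (`DominatedTieLimit.volume_coincidenceLocus`), hence almost everywhere; so the landed
  engine `DominatedTieLimit.tendsto_riemannSum_piBox` gives convergence to `∫ g = Re ∫ W · F = Re (S₁ n F)`
  (`integral_re`).  Finally `S₁ n F` is real: by the tie it is a limit of real numbers.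

References: K. Osterwalder, R. Schrader, Comm. Math. Phys. 42 (1975) §2 (lattice approximants on `⁰𝒮`,
temperedness estimates); J. Glimm, A. Jaffe, Quantum Physics (1987) §9.5–9.6 (lattice approximation and
Riemann sums). [folklore]
-/

noncomputable section

-- Mathlib's `SimplexCategory` instance `Fintype (Fin (x.len + 1))` matches `Fintype (Fin 4)` and makes concrete
-- `Fin 4` instance paths diverge between elaborations (tree-known file-local workaround, as in the landed
-- `Negative/*.lean` files of this crux).
attribute [-instance] SimplexCategory.instFintypeToTypeOrderHomFinHAddNatLenOfNat

namespace Summit.QuantumFields.YangMills.Theorems.NPointIsotropy.ComplexRotationBandlimit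

open scoped BigOperators SchwartzMap
open MeasureTheory Filter Topology
open Literature.MathematicalPhysics.QuantumLattice Literature.MathematicalPhysics.AQFT
  Literature.MathematicalPhysics.QuantumFieldTheory
open Literature.Probability.LatticeModels (box mem_box Site)
open Summit.QuantumFields.YangMills.Theorems.NPointIsotropy.Negative (E4)
open Summit.QuantumFields.YangMills.Theorems.CurvatureBoostCovariance.Negative (Tie)
open Summit.QuantumFields.YangMills.Theorems.CurvatureBoostCovariance.BoostsInheritMirrors
  (DominatedTieLimit.tendsto_riemannSum_piBox DominatedTieLimit.norm_mul_weight_le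
    DominatedTieLimit.volume_coincidenceLocus)

namespace LatticeOfContinuousRegular

/-- An injective lattice multi-site scaled by a nonzero mesh is off the coincidence locus of `(ℝ⁴)ⁿ`
(`siteToE : ℤ⁴ → ℝ⁴` is injective). [folklore] -/
theorem smul_siteToE_notMem_coincidenceLocus {n : ℕ} {a : ℝ} (ha : a ≠ 0) {x : Fin n → Site 4}
    (hx : Function.Injective x) :
    (fun i => a • siteToE (x i) : Fin n → E4) ∉ coincidenceLocus n E4 := by
  refine not_mem_coincidenceLocus_of_injective fun i j hij => hx ?_
  have h : siteToE (x i) = siteToE (x j) := smul_right_injective E4 ha hij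
  funext μ
  have hμ := congrArg (fun v : E4 => v μ) h
  simpa using hμ

/-- A complex number that is the limit of a sequence of real numbers equals (the cast of) its real
part. [folklore] -/
theorem ofReal_re_eq_of_tendsto {u : ℕ → ℝ} {z : ℂ}
    (h : Tendsto (fun k => ((u k : ℝ) : ℂ)) atTop (𝓝 z)) : ((z.re : ℝ) : ℂ) = z := by
  have him : Tendsto (fun k => (((u k : ℝ) : ℂ)).im) atTop (𝓝 z.im) :=
    (Complex.continuous_im.tendsto _).comp h
  simp only [Complex.ofReal_im] at him
  have hz : z.im = 0 := tendsto_nhds_unique him tendsto_const_nhds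
  exact Complex.conj_eq_iff_re.1 (Complex.conj_eq_iff_im.2 hz)

end LatticeOfContinuousRegular

open LatticeOfContinuousRegular in
/-- **Stub 1d — STEP 0, CONTINUUM ⇒ LATTICE (registered side stub of generation 10 of the skeleton
`Cruxes/NPointIsotropy/Lines/complex_rotation_bandlimit.lean`, signature verbatim).**  For a family TIED to
`(r, sch)` whose `𝔖ₙ|⁰𝒮` (`n ≥ 1`) is integration against a function `W` continuous off the coincidence
locus with the tempered pair-weight bound, the conclusion of `stub_temperedLatticeApproximants` holds at
`n`: witness `D_k x := Re W(a_k x)`, `k₀ := 0`, the same `C, N` (an injective multi-site scaled by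
`a_k > 0` is off the locus and `|Re W| ≤ ‖W‖`); on a real tensor `F` the lattice sum is the Riemann sum of
`g = Re (W · F)`, which decays like `(1 + ‖y‖)^{-8n}` by the flat decay of `⁰𝒮` functions against the
pair weight and is continuous off the null locus, so `DominatedTieLimit.tendsto_riemannSum_piBox` gives
convergence to `∫ g = Re (S₁ n F) = S₁ n F` (the tie makes `S₁ n F` real). [folklore] -/
theorem stub_latticeApproximants_of_continuousRegular :
    open Literature.MathematicalPhysics.QuantumLattice Literature.MathematicalPhysics.AQFT
      Literature.MathematicalPhysics.QuantumFieldTheory Literature.Probability.LatticeModels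
      Summit.QuantumFields.YangMills.Theorems.CurvatureBoostCovariance.Negative
      Summit.QuantumFields.YangMills.Theorems.NPointIsotropy.Negative in
    ∀ (G : Type) [Group G] [TopologicalSpace G] [IsTopologicalGroup G] [CompactSpace G]
      [MeasurableSpace G] [BorelSpace G],
      ∀ (r : LatticeRep G) (sch : SpeciesScheme (YMSpecies G)) (S₁ : SchwingerFamily E4),
        Tie r sch S₁ →
        ∀ n : ℕ, 0 < n →
          (∃ (W : (Fin n → E4) → ℂ) (C : ℝ) (N : ℕ), 0 < C ∧ ContinuousOn W (coincidenceLocus n E4)ᶜ ∧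
            (∀ y ∉ coincidenceLocus n E4,
              ‖W y‖ ≤ C * (1 + ‖y‖) ^ N * (1 + ∑ i, ∑ j ∈ Finset.univ.erase i, ‖y i - y j‖⁻¹) ^ N) ∧
            ∀ F : SchwartzMap (Fin n → E4) ℂ, IsOffDiagonal F →
              MeasureTheory.Integrable (fun y : Fin n → E4 => W y * F y) ∧
              S₁ n F = ∫ y : Fin n → E4, W y * F y) →
          ∃ (D : ℕ → (Fin n → Site 4) → ℝ) (C : ℝ) (N k₀ : ℕ), 0 < C ∧
            (∀ k : ℕ, k₀ ≤ k → ∀ x : Fin n → Site 4, (∀ i, x i ∈ box 4 (sch.L k)) → Function.Injective x →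
              |D k x| ≤ C * (1 + ‖fun i => sch.a k • siteToE (x i)‖) ^ N *
                (1 + ∑ i, ∑ j ∈ Finset.univ.erase i,
                  ‖sch.a k • siteToE (x i) - sch.a k • siteToE (x j)‖⁻¹) ^ N) ∧
            ∀ (f : Fin n → SchwartzMap E4 ℝ) (F : SchwartzMap (Fin n → E4) ℂ),
              IsTensorOf F (fun i => ofRealTest (f i)) → IsOffDiagonal F →
              Filter.Tendsto (fun k => (((sch.a k ^ 4) ^ n *
                ∑ x ∈ Fintype.piFinset (fun _ : Fin n => box 4 (sch.L k)),
                  (∏ i, f i (sch.a k • siteToE (x i))) * D k x : ℝ) : ℂ)) Filter.atTop (nhds (S₁ n F)) := by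
  intro G _ _ _ _ _ _ r sch S₁ htie n hn hreg
  obtain ⟨W, C, N, hC, hWc, hWb, hWint⟩ := hreg
  refine ⟨fun k x => (W fun i => sch.a k • siteToE (x i)).re, C, N, 0, hC, ?_, ?_⟩
  · -- the bound at injective multi-sites: they are off the locus, and `|Re W| ≤ ‖W‖`
    intro k _ x _ hinj
    exact (Complex.abs_re_le_norm _).trans
      (hWb _ (smul_siteToE_notMem_coincidenceLocus (sch.a_pos k).ne' hinj))
  · intro f F hF hFoff
    -- the real integrand `g = Re (W · F)`
    obtain ⟨g, hgf⟩ : ∃ g : (Fin n → E4) → ℝ, g = fun y => (W y * F y).re := ⟨_, rfl⟩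
    have hg : ∀ y, g y = (W y * F y).re := fun y => congrFun hgf y
    -- tempered decay of `g` with exponent `8n > 4n = dim` (flat decay against the pair weight)
    have hK : ∀ y, ‖g y‖ ≤ |C| * 4 ^ (N + 8 * n) * (1 + (n : ℝ) ^ 2) ^ N *
        (Finset.Iic (N + 8 * n, N + 1)).sup (schwartzSeminormFamily ℂ (Fin n → E4) ℂ) F *
          ((1 + ‖y‖) ^ (8 * n))⁻¹ := fun y => by
      rw [hg, Real.norm_eq_abs]
      calc |(W y * F y).re| ≤ ‖W y * F y‖ := Complex.abs_re_le_norm _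
        _ = ‖F y‖ * ‖W y‖ := by rw [norm_mul, mul_comm]
        _ ≤ _ := DominatedTieLimit.norm_mul_weight_le hFoff (w := fun y => ‖W y‖) hWb (8 * n) y
    -- `g` is continuous off the Lebesgue-null closed locus, hence almost everywhere
    have hgc : ∀ᵐ z ∂(volume : Measure (Fin n → E4)), ContinuousAt g z := by
      filter_upwards [measure_eq_zero_iff_ae_notMem.1 (DominatedTieLimit.volume_coincidenceLocus n)]
        with z hz
      rw [hgf]
      exact Complex.continuous_re.continuousAt.comp
        ((hWc.continuousAt ((isClosed_coincidenceLocus n E4).isOpen_compl.mem_nhds hz)).mul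
          F.continuous.continuousAt)
    -- the Riemann sums of `g` over the exploding boxes converge to `∫ g`
    have hR := DominatedTieLimit.tendsto_riemannSum_piBox (by omega : 4 * n < 8 * n) g hK hgc
      sch.a sch.L sch.a_pos sch.tendsto_a sch.tendsto_L
    -- `∫ g = Re (S₁ n F)` and `S₁ n F` is real (a limit of real lattice numbers, by the tie)
    have hint : ∫ z, g z = (S₁ n F).re := by
      obtain ⟨hi, hS⟩ := hWint F hFoff
      rw [hS, hgf]
      simpa using integral_re hi
    have hreal : (((S₁ n F).re : ℝ) : ℂ) = S₁ n F :=
      ofReal_re_eq_of_tendsto (htie n hn.ne' f F hF hFoff)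
    have hlim : Tendsto (fun k => (((sch.a k ^ 4) ^ n *
        ∑ x ∈ Fintype.piFinset (fun _ : Fin n => box 4 (sch.L k)),
          g (fun i => sch.a k • siteToE (x i)) : ℝ) : ℂ)) atTop (𝓝 (S₁ n F)) := by
      rw [← hreal, ← hint]
      exact (Complex.continuous_ofReal.tendsto _).comp hR
    -- on the real tensor `F = ⊗ fᵢ` the lattice sum against `D_k = Re W(a_k ·)` is the Riemann sum of `g`
    refine hlim.congr fun k => ?_
    refine congrArg (fun t : ℝ => (((sch.a k ^ 4) ^ n * t : ℝ) : ℂ))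
      (Finset.sum_congr rfl fun x _ => ?_)
    rw [hg, hF]
    simp only [ofRealTest_apply]
    rw [← Complex.ofReal_prod, Complex.re_mul_ofReal, mul_comm]

end Summit.QuantumFields.YangMills.Theorems.NPointIsotropy.ComplexRotationBandlimit

end
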